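import Summits.QuantumFields.YangMills.Theorems.ForcedResponseSkewnessRunningCouplingCeilingOfKernelBoundsBody
import Summits.QuantumFields.YangMills.Theorems.ForcedResponseSkewnessRunningCouplingCeilingScaleFreeOfMomentBounds
import HarnessLib

/-!
# Crux `RunningCouplingCeiling` (repaired: stmt-QuantumFields-24275), TEXT VERBATIM, from the spine's UV leg `MomentBounds6`
# and the LOCAL running-coupling log-decay clause alone (route-independent body; the by-name one-liner is in
# `…RunningCouplingCeilingOfMomentBounds6`)

Support file (`--supports stmt-QuantumFields-24275 --as helper`) by the width prover `ym-line-frs-p3` (g2) of route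
`ForcedResponseSkewness` (lead `ym-line-frs-p1`).  One named composition of what the line has landed:

  `runningCouplingCeilingBody_of_localKernelBounds` (p594591: the crux text from LOCAL pointwise kernel bounds, via the uniform
  local smearing `uniform_smear_local` p593330; Theses-free)  +  `localScaleFree_of_momentBounds6` (p593932: the local scale-free clause
  `n₀ ≤ d → a(β)·d ≤ ℓ → d⁸|torusCov| ≤ C₁` is the `n = 2` collar output, i.e. follows from `MomentBounds6 G r a`)

  ⟹ **`runningCouplingCeilingBody_of_momentBounds6_of_localLogDecay`**:
     the text of `RunningCouplingCeiling` follows from, for every compact simple `G`, `r` and unit map `a → 0⁺` carrying the repaired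
     pinning clause (a compactly supported positive-time floor witness),
     (UV)  `MomentBounds6 G r a` — the plane-resolved E0′ ceilings of the spine `BalabanLadder` in that unit (femto/UV-class,
           locality cap `R·a(β) ≤ ℓ₄`; NOT proved here), and
     (AF)  the LOCAL log-decay clause: `∃ C₀ n₀ β₀ Λ₀, ∀ β ≥ β₀, ∀ L, Λ₀ ≤ a(β)·L → ∀ x y ∈ box L,
           n₀ ≤ d → a(β)·d ≤ ½ → d⁸ |torusCov β L x y| ≤ C₀ / log²(1/(a(β) d))` — running-coupling decay of the dens–dens
           covariance strictly below the unit (the route card's LogCeilingAtPhysicalScale; Bałaban-class, not in print;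
           false in the free curvature-Gaussian model, `GaussModel.gaussModel_not_logDecay` p597038).
  No clause at physical separation beyond `max(ℓ, ½)` is used: unlike the registered `PointwiseSigR` (whose global
  scale-free clause is hyperscaling ∧ clustering at unbounded physical separation, an IR-class input — see
  `pointwiseSigR_of_pairMoments_of_logDecay`, p596618), this form of the physics debt of 24275 is femto/UV ∧ AF only.

Honest label: a CONDITIONAL reduction inside a conditional rung line (leaf R2a `BalabanLadder.NT`, residual 24261 ∋ NT
clause (i)); neither (UV) nor (AF) is proved here, no stub of 24275 is closed; nothing here bears on the Yang–Mills mass gap,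
which is NOT proved by any of this.
-/

set_option autoImplicit false

noncomputable section

namespace Summit.QuantumFields.YangMills.Cruxes.RunningCouplingCeiling.Pointwise

open scoped SchwartzMap
open MeasureTheory Filter Topology
open Literature.MathematicalPhysics.QuantumFieldTheory Literature.MathematicalPhysics.QuantumLattice
open Literature.Probability.LatticeModels
open Summit.QuantumFields.YangMills.Cruxes.OSLegsFromFemtoAndGap.DlrCollarTransfer

/-- **`RunningCouplingCeiling` (text verbatim) ⇐ `MomentBounds6` (spine UV leg, in the pinned unit) ∧ the LOCAL log-decay clause.**
For every compact simple `G`, `r`, unit map `a → 0⁺` with a compactly supported positive-time clause-(i) floor witness,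
assume (UV) `MomentBounds6 G r a` and (AF) constants `C₀ n₀ β₀ Λ₀` with
`n₀ ≤ d → a(β) d ≤ ½ → d⁸|torusCov β L x y| ≤ C₀/log²(1/(a(β) d))` on `box L` for `β ≥ β₀`, `a(β)·L ≥ Λ₀`.  Then the repaired
crux `RunningCouplingCeiling` (stmt-QuantumFields-24275) holds: for each radius `ℓ` the local scale-free clause comes from
`localScaleFree_of_momentBounds6`, thresholds `max`, and `runningCouplingCeilingBody_of_localKernelBounds` concludes.
[folklore] -/
theorem runningCouplingCeilingBody_of_momentBounds6_of_localLogDecay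
    (hMB : ∀ (G : Type) [Group G] [TopologicalSpace G] [IsTopologicalGroup G] [CompactSpace G],
      IsCompactSimpleLieGroup G →
      letI : MeasurableSpace G := borel G
      haveI : BorelSpace G := ⟨rfl⟩
      ∀ (r : LatticeRep G) (a : ℝ → ℝ), (∀ β, 0 < a β) → Filter.Tendsto a Filter.atTop (nhds 0) →
        (∃ (v₀ : 𝓢(EuclideanSpace ℝ (Fin 4), ℝ)) (ε β₅ Λ₅ : ℝ), HasCompactSupport v₀ ∧
          tsupport v₀ ⊆ {y : EuclideanSpace ℝ (Fin 4) | 0 < y 0} ∧ 0 < ε ∧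
          ∀ β : ℝ, β₅ ≤ β → ∀ L : ℕ, Λ₅ ≤ a β * L → ε ≤ Q2 G r β L (a β) (thetaTest 4 v₀) v₀) →
        MomentBounds6 G r a)
    (hlog : ∀ (G : Type) [Group G] [TopologicalSpace G] [IsTopologicalGroup G] [CompactSpace G],
      IsCompactSimpleLieGroup G →
      letI : MeasurableSpace G := borel G
      haveI : BorelSpace G := ⟨rfl⟩
      ∀ (r : LatticeRep G) (a : ℝ → ℝ), (∀ β, 0 < a β) → Filter.Tendsto a Filter.atTop (nhds 0) →
        (∃ (v₀ : 𝓢(EuclideanSpace ℝ (Fin 4), ℝ)) (ε β₅ Λ₅ : ℝ), HasCompactSupport v₀ ∧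
          tsupport v₀ ⊆ {y : EuclideanSpace ℝ (Fin 4) | 0 < y 0} ∧ 0 < ε ∧
          ∀ β : ℝ, β₅ ≤ β → ∀ L : ℕ, Λ₅ ≤ a β * L → ε ≤ Q2 G r β L (a β) (thetaTest 4 v₀) v₀) →
        ∃ C₀ : ℝ, ∃ n₀ : ℕ, ∃ β₀ Λ₀ : ℝ, ∀ β : ℝ, β₀ ≤ β → ∀ L : ℕ, Λ₀ ≤ a β * L →
          ∀ x ∈ box 4 L, ∀ y ∈ box 4 L,
            (n₀ : ℝ) ≤ torusDist L x y → a β * torusDist L x y ≤ 1 / 2 →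
              torusDist L x y ^ 8 * |torusCov G r β L x y| ≤
                C₀ / Real.log (1 / (a β * torusDist L x y)) ^ 2) :
    (open Literature.MathematicalPhysics.QuantumFieldTheory Literature.MathematicalPhysics.QuantumLattice Summit.QuantumFields.YangMills.Cruxes.OSLegsFromFemtoAndGap.DlrCollarTransfer in ∀ (G : Type) [Group G] [TopologicalSpace G] [IsTopologicalGroup G] [CompactSpace G], IsCompactSimpleLieGroup G → letI : MeasurableSpace G := borel G; haveI : BorelSpace G := ⟨rfl⟩; ∀ (r : LatticeRep G) (a : ℝ → ℝ), (∀ β, 0 < a β) → Filter.Tendsto a Filter.atTop (nhds 0) → (∃ (v₀ : SchwartzMap (EuclideanSpace ℝ (Fin 4)) ℝ) (ε β₅ Λ₅ : ℝ), HasCompactSupport v₀ ∧ tsupport v₀ ⊆ {y : EuclideanSpace ℝ (Fin 4) | 0 < y 0} ∧ 0 < ε ∧ ∀ β : ℝ, β₅ ≤ β → ∀ L : ℕ, Λ₅ ≤ a β * L → ε ≤ Q2 G r β L (a β) (thetaTest 4 v₀) v₀) → ∀ (p : EuclideanSpace ℝ (Fin 4)) (ρ₀ : ℝ), 0 < ρ₀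 → ρ₀ < p 0 → ∃ C : ℝ, ∀ v : SchwartzMap (EuclideanSpace ℝ (Fin 4)) ℝ, tsupport v ⊆ Metric.closedBall p ρ₀ → (∫ y, |v y|) ≤ 1 → ∀ Λ : ℝ, 2 ≤ Λ → ∃ β₆ Λ₆ : ℝ, ∀ β : ℝ, β₆ ≤ β → ∀ L : ℕ, Λ₆ ≤ a β * L → ∀ l : ℝ, l ∈ Set.Icc Λ (2 * Λ) → Q2 G r β L (l * a β) (thetaTest 4 v) v ≤ C / Real.log Λ ^ 2) := by
  refine runningCouplingCeilingBody_of_localKernelBounds ?_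
  intro G _ _ _ _ hG
  letI : MeasurableSpace G := borel G
  haveI : BorelSpace G := ⟨rfl⟩
  intro r a hapos hlim hpin ℓ hℓ
  obtain ⟨C₁, n₁, β₁, h₁⟩ := localScaleFree_of_momentBounds6 r hapos hlim (hMB G hG r a hapos hlim hpin) ℓ hℓ
  obtain ⟨C₀, n₀, β₀, Λ₀, h₀⟩ := hlog G hG r a hapos hlim hpin
  refine ⟨C₀, C₁, max n₀ n₁, max β₀ β₁, Λ₀, fun β hβ L hL x hx y hy => ⟨fun hd hdℓ => ?_, fun hd htd => ?_⟩⟩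
  · exact h₁ β (le_trans (le_max_right _ _) hβ) L x y (le_trans (by exact_mod_cast le_max_right n₀ n₁) hd) hdℓ
  · exact h₀ β (le_trans (le_max_left _ _) hβ) L hL x hx y hy (le_trans (by exact_mod_cast le_max_left n₀ n₁) hd) htd

end Summit.QuantumFields.YangMills.Cruxes.RunningCouplingCeiling.Pointwise

end
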